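import Summits.ValiantsHypothesis.ValiantsHypothesis.Theorems.KPlusLogSqLawTropicalSymmetricOrbitThreeFourSeventeen

/-!
# Route «KPlusLogSqLaw» — the orbit `(3,4)` row: the abstract core hypotheses of `core17` ADMIT a chain of length `18`
# (so «≤ 16» is not a consequence of the pairwise rules M / R1w / R1′w / R2w / R2′w / R3w / R3′w + carrier shapes + injectivity)

HONEST FRAMING.  Helper file (seat val-sym-lift-p2 (g6), cell `pub-symmetroid`, 2026-08-27; `--supports` the `WeakLifting` item
stmt-ValiantsHypothesis-19561 as a helper, no closure claim).  A NEGATIVE-FOR-THE-METHOD statement about the ABSTRACT hypotheses of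
`SymmetricOrbitThreeFour.core17` only: an explicit `r : Fin 18 → Perm (Fin 3) × (Fin 3 → Fin 4)` with exponents `g = (0,7,11,20)`
satisfies every hypothesis of `core17` (`hshape`, `hM`, injectivity, `hR1 … hR3'`, `Monotone g`), so no argument using these hypotheses
alone proves `n ≤ 16`.  It is NOT a statement about designs: whether this abstract chain is realised by an orbit-dominant chain of a
symmetric `3 × 3` design is not decided, `¬ TropRootLawAtSymmOrb 3 4 16` is NOT claimed, and the cell's value «≤ 16» (`TSymOrb34Le16`, which
needs a non-pairwise / σ-state ingredient per TSYM34-METHOD-g23 §4) stays a target, NOT asserted.  Nothing here is about `TropicalB` /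
`WeakLifting` in their windows, Conjecture B, DoorA34 = `PosRootLawAt 3 4 18` (OPEN), `MatrixDescartes` (stmt-ValiantsHypothesis-18050) or VP ≠ VNP.
Source of the witness: the seat's sign-free enumerator `HOME/val-sym-lift-p2/g6/exp/enum_orb.py` (face `(0,7,11,20)`, an 18-element script that is moreover feasible for the enumerator's GF(2) sign-parity system — located, not a kernel statement),
converted by `exp/lean_witness_check.py`; the kernel re-checks every hypothesis by `decide` (in uncurried form, then curried).
[cell statement R1732 / memo LEMMA-Z-liftp2g6.md §8 successor docket (a); no citation exists]
-/

set_option linter.dupNamespace false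
set_option autoImplicit false

namespace Summit.ValiantsHypothesis.ValiantsHypothesis.Theorems.KPlusLogSqLaw

open Summit.ValiantsHypothesis.ValiantsHypothesis.Theorems.LacunarySymmetroidMatrixDescartes
open Summit.ValiantsHypothesis.ValiantsHypothesis.Theorems.LacunarySymmetroidMatrixDescartes.TropicalCensus

namespace SymmetricOrbitThreeFour

/-- **The abstract core hypotheses admit `n = 17`.**  There are `r : Fin 18 → Perm (Fin 3) × (Fin 3 → Fin 4)` and monotone `g` (namely
`g = (0, 7, 11, 20)` and the script `T₀(0;0) T₀(1;0) T₀(2;0) T₁(0;1) C(2,1,0) T₀(3;0) T₁(1;1) T₂(0;2) T₁(2;1) D(3,2,0) T₁(2;2) T₀(3;1) C(3,2,1) T₂(0;3) T₁(3;2) T₂(1;3) T₂(2;3) T₀(3;3)` in the notation of the cell's method memo) satisfying all hypotheses of `core17`, and moreover with strictly increasing slopes `Σ_l g (c_k l)` (rule S does not help either).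
[explicit witness, kernel-checked by `decide`] -/
theorem core_hypotheses_admit_seventeen :
    ∃ (n : ℕ) (r : Fin (n + 1) → Equiv.Perm (Fin 3) × (Fin 3 → Fin 4)) (g : Fin 4 → ℕ), n = 17 ∧ Monotone g ∧
      (∀ k, (r k).1 = 1 ∨ (∃ i j : Fin 3, i < j ∧ (r k).1 = Equiv.swap i j ∧ (r k).2 i = (r k).2 j) ∨ (∀ i, (r k).1 i ≠ i)) ∧
      (∀ a b : Fin (n + 1), a < b → ∀ l₁ l₂ : Fin 3,
        ((r a).1 l₁ = (r b).1 l₂ ∧ l₁ = l₂) ∨ ((r a).1 l₁ = l₂ ∧ (r b).1 l₂ = l₁) → (r a).2 l₁ ≤ (r b).2 l₂) ∧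
      (Function.Injective fun k => TropicalCensus.classSym (r k)) ∧
      (∀ a b : Fin (n + 1), a < b → (r a).1 = 1 → ∀ i j : Fin 3, i ≠ j → (r b).1 = Equiv.swap i j → (r b).2 i = (r b).2 j →
        g ((r a).2 i) + g ((r a).2 j) < 2 * g ((r b).2 i)) ∧
      (∀ a b : Fin (n + 1), a < b → (r b).1 = 1 → ∀ i j : Fin 3, i ≠ j → (r a).1 = Equiv.swap i j → (r a).2 i = (r a).2 j →
        2 * g ((r a).2 i) < g ((r b).2 i) + g ((r b).2 j)) ∧
      (∀ a b : Fin (n + 1), a < b → ∀ i j k : Fin 3, i ≠ j → k ≠ i → k ≠ j → (r a).1 = Equiv.swap i j →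
        (r a).2 i = (r a).2 j → (r b).1 i = j → (r b).1 j = k → (r b).1 k = i →
        g ((r a).2 k) + g ((r a).2 i) < g ((r b).2 j) + g ((r b).2 k)) ∧
      (∀ a b : Fin (n + 1), a < b → ∀ i j k : Fin 3, i ≠ j → k ≠ i → k ≠ j → (r a).1 i = j → (r a).1 j = k → (r a).1 k = i →
        (r b).1 = Equiv.swap i j → (r b).2 i = (r b).2 j → g ((r a).2 j) + g ((r a).2 k) < g ((r b).2 k) + g ((r b).2 i)) ∧
      (∀ a b : Fin (n + 1), a < b → (r a).1 = 1 → ∀ i j k : Fin 3, i ≠ j → k ≠ i → k ≠ j →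
        (r b).1 i = j → (r b).1 j = k → (r b).1 k = i → g ((r a).2 i) + g ((r a).2 j) < 2 * g ((r b).2 i)) ∧
      (∀ a b : Fin (n + 1), a < b → (r b).1 = 1 → ∀ i j k : Fin 3, i ≠ j → k ≠ i → k ≠ j →
        (r a).1 i = j → (r a).1 j = k → (r a).1 k = i → 2 * g ((r a).2 i) < g ((r b).2 i) + g ((r b).2 j)) ∧
      (∀ a b : Fin (n + 1), a < b → TropicalCensus.slope g (r a) < TropicalCensus.slope g (r b)) := by
  have key : ∀ r : Fin (17 + 1) → Equiv.Perm (Fin 3) × (Fin 3 → Fin 4), r =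
      (![((Equiv.swap 1 2 : Equiv.Perm (Fin 3)), (![0, 0, 0] : Fin 3 → Fin 4)),
        ((Equiv.swap 1 2 : Equiv.Perm (Fin 3)), (![1, 0, 0] : Fin 3 → Fin 4)),
        ((Equiv.swap 1 2 : Equiv.Perm (Fin 3)), (![2, 0, 0] : Fin 3 → Fin 4)),
        ((Equiv.swap 0 2 : Equiv.Perm (Fin 3)), (![1, 0, 1] : Fin 3 → Fin 4)),
        ((Equiv.swap 0 1 * Equiv.swap 1 2 : Equiv.Perm (Fin 3)), (![2, 0, 1] : Fin 3 → Fin 4)),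
        ((Equiv.swap 1 2 : Equiv.Perm (Fin 3)), (![3, 0, 0] : Fin 3 → Fin 4)),
        ((Equiv.swap 0 2 : Equiv.Perm (Fin 3)), (![1, 1, 1] : Fin 3 → Fin 4)),
        ((Equiv.swap 0 1 : Equiv.Perm (Fin 3)), (![2, 2, 0] : Fin 3 → Fin 4)),
        ((Equiv.swap 0 2 : Equiv.Perm (Fin 3)), (![1, 2, 1] : Fin 3 → Fin 4)),
        ((1 : Equiv.Perm (Fin 3)), (![3, 2, 0] : Fin 3 → Fin 4)),
        ((Equiv.swap 0 2 : Equiv.Perm (Fin 3)), (![2, 2, 2] : Fin 3 → Fin 4)),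
        ((Equiv.swap 1 2 : Equiv.Perm (Fin 3)), (![3, 1, 1] : Fin 3 → Fin 4)),
        ((Equiv.swap 0 1 * Equiv.swap 1 2 : Equiv.Perm (Fin 3)), (![3, 1, 2] : Fin 3 → Fin 4)),
        ((Equiv.swap 0 1 : Equiv.Perm (Fin 3)), (![3, 3, 0] : Fin 3 → Fin 4)),
        ((Equiv.swap 0 2 : Equiv.Perm (Fin 3)), (![2, 3, 2] : Fin 3 → Fin 4)),
        ((Equiv.swap 0 1 : Equiv.Perm (Fin 3)), (![3, 3, 1] : Fin 3 → Fin 4)),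
        ((Equiv.swap 0 1 : Equiv.Perm (Fin 3)), (![3, 3, 2] : Fin 3 → Fin 4)),
        ((Equiv.swap 1 2 : Equiv.Perm (Fin 3)), (![3, 3, 3] : Fin 3 → Fin 4))] : Fin (17 + 1) → Equiv.Perm (Fin 3) × (Fin 3 → Fin 4)) →
      (∀ k, (r k).1 = 1 ∨ (∃ i j : Fin 3, i < j ∧ (r k).1 = Equiv.swap i j ∧ (r k).2 i = (r k).2 j) ∨ (∀ i, (r k).1 i ≠ i)) ∧
      (∀ (a b : Fin (17 + 1)) (l₁ l₂ : Fin 3), (a < b ∧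
        (((r a).1 l₁ = (r b).1 l₂ ∧ l₁ = l₂) ∨ ((r a).1 l₁ = l₂ ∧ (r b).1 l₂ = l₁))) → (r a).2 l₁ ≤ (r b).2 l₂) ∧
      (Function.Injective fun k => TropicalCensus.classSym (r k)) ∧
      (∀ (a b : Fin (17 + 1)) (i j : Fin 3), (a < b ∧ (r a).1 = 1 ∧ i ≠ j ∧ (r b).1 = Equiv.swap i j ∧ (r b).2 i = (r b).2 j) →
        (![0, 7, 11, 20] : Fin 4 → ℕ) ((r a).2 i) + (![0, 7, 11, 20] : Fin 4 → ℕ) ((r a).2 j) < 2 * (![0, 7, 11, 20] : Fin 4 → ℕ) ((r b).2 i)) ∧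
      (∀ (a b : Fin (17 + 1)) (i j : Fin 3), (a < b ∧ (r b).1 = 1 ∧ i ≠ j ∧ (r a).1 = Equiv.swap i j ∧ (r a).2 i = (r a).2 j) →
        2 * (![0, 7, 11, 20] : Fin 4 → ℕ) ((r a).2 i) < (![0, 7, 11, 20] : Fin 4 → ℕ) ((r b).2 i) + (![0, 7, 11, 20] : Fin 4 → ℕ) ((r b).2 j)) ∧
      (∀ (a b : Fin (17 + 1)) (i j k : Fin 3), (a < b ∧ i ≠ j ∧ k ≠ i ∧ k ≠ j ∧ (r a).1 = Equiv.swap i j ∧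
        (r a).2 i = (r a).2 j ∧ (r b).1 i = j ∧ (r b).1 j = k ∧ (r b).1 k = i) →
        (![0, 7, 11, 20] : Fin 4 → ℕ) ((r a).2 k) + (![0, 7, 11, 20] : Fin 4 → ℕ) ((r a).2 i) < (![0, 7, 11, 20] : Fin 4 → ℕ) ((r b).2 j) + (![0, 7, 11, 20] : Fin 4 → ℕ) ((r b).2 k)) ∧
      (∀ (a b : Fin (17 + 1)) (i j k : Fin 3), (a < b ∧ i ≠ j ∧ k ≠ i ∧ k ≠ j ∧ (r a).1 i = j ∧ (r a).1 j = k ∧ (r a).1 k = i ∧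
        (r b).1 = Equiv.swap i j ∧ (r b).2 i = (r b).2 j) → (![0, 7, 11, 20] : Fin 4 → ℕ) ((r a).2 j) + (![0, 7, 11, 20] : Fin 4 → ℕ) ((r a).2 k) < (![0, 7, 11, 20] : Fin 4 → ℕ) ((r b).2 k) + (![0, 7, 11, 20] : Fin 4 → ℕ) ((r b).2 i)) ∧
      (∀ (a b : Fin (17 + 1)) (i j k : Fin 3), (a < b ∧ (r a).1 = 1 ∧ i ≠ j ∧ k ≠ i ∧ k ≠ j ∧
        (r b).1 i = j ∧ (r b).1 j = k ∧ (r b).1 k = i) → (![0, 7, 11, 20] : Fin 4 → ℕ) ((r a).2 i) + (![0, 7, 11, 20] : Fin 4 → ℕ) ((r a).2 j) < 2 * (![0, 7, 11, 20] : Fin 4 → ℕ) ((r b).2 i)) ∧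
      (∀ (a b : Fin (17 + 1)) (i j k : Fin 3), (a < b ∧ (r b).1 = 1 ∧ i ≠ j ∧ k ≠ i ∧ k ≠ j ∧
        (r a).1 i = j ∧ (r a).1 j = k ∧ (r a).1 k = i) → 2 * (![0, 7, 11, 20] : Fin 4 → ℕ) ((r a).2 i) < (![0, 7, 11, 20] : Fin 4 → ℕ) ((r b).2 i) + (![0, 7, 11, 20] : Fin 4 → ℕ) ((r b).2 j)) ∧
      (∀ a b : Fin (17 + 1), a < b → TropicalCensus.slope (![0, 7, 11, 20] : Fin 4 → ℕ) (r a) < TropicalCensus.slope (![0, 7, 11, 20] : Fin 4 → ℕ) (r b)) := by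
    intro r hr
    subst hr
    exact ⟨by decide, by decide, by decide, by decide, by decide, by decide, by decide, by decide, by decide, by decide⟩
  obtain ⟨hsh, hM, hinj, h1, h1', h2, h2', h3, h3', hS⟩ := key _ rfl
  exact ⟨17, _, (![0, 7, 11, 20] : Fin 4 → ℕ), rfl, Fin.monotone_iff_le_succ.mpr (by decide), hsh,
    fun a b hab l₁ l₂ hcell => hM a b l₁ l₂ ⟨hab, hcell⟩, hinj,
    fun a b hab ha1 i j hij hb1 hcc => h1 a b i j ⟨hab, ha1, hij, hb1, hcc⟩,
    fun a b hab hb1 i j hij ha1 hcc => h1' a b i j ⟨hab, hb1, hij, ha1, hcc⟩,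
    fun a b hab i j k hij hki hkj ha1 hcc hbi hbj hbk => h2 a b i j k ⟨hab, hij, hki, hkj, ha1, hcc, hbi, hbj, hbk⟩,
    fun a b hab i j k hij hki hkj hai haj hak hb1 hcc => h2' a b i j k ⟨hab, hij, hki, hkj, hai, haj, hak, hb1, hcc⟩,
    fun a b hab ha1 i j k hij hki hkj hbi hbj hbk => h3 a b i j k ⟨hab, ha1, hij, hki, hkj, hbi, hbj, hbk⟩,
    fun a b hab hb1 i j k hij hki hkj hai haj hak => h3' a b i j k ⟨hab, hb1, hij, hki, hkj, hai, haj, hak⟩, hS⟩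

/-- **Corollary: the abstract method stops at `17`.**  The conclusion of `core17` cannot be improved to `n ≤ 16` under the same hypotheses.
[from `core_hypotheses_admit_seventeen`] -/
theorem not_core_sixteen :
    ¬ ∀ (n : ℕ) (r : Fin (n + 1) → Equiv.Perm (Fin 3) × (Fin 3 → Fin 4)) (g : Fin 4 → ℕ), Monotone g →
      (∀ k, (r k).1 = 1 ∨ (∃ i j : Fin 3, i < j ∧ (r k).1 = Equiv.swap i j ∧ (r k).2 i = (r k).2 j) ∨ (∀ i, (r k).1 i ≠ i)) →
      (∀ a b : Fin (n + 1), a < b → ∀ l₁ l₂ : Fin 3,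
        ((r a).1 l₁ = (r b).1 l₂ ∧ l₁ = l₂) ∨ ((r a).1 l₁ = l₂ ∧ (r b).1 l₂ = l₁) → (r a).2 l₁ ≤ (r b).2 l₂) →
      (Function.Injective fun k => TropicalCensus.classSym (r k)) →
      (∀ a b : Fin (n + 1), a < b → (r a).1 = 1 → ∀ i j : Fin 3, i ≠ j → (r b).1 = Equiv.swap i j → (r b).2 i = (r b).2 j →
        g ((r a).2 i) + g ((r a).2 j) < 2 * g ((r b).2 i)) →
      (∀ a b : Fin (n + 1), a < b → (r b).1 = 1 → ∀ i j : Fin 3, i ≠ j → (r a).1 = Equiv.swap i j → (r a).2 i = (r a).2 j →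
        2 * g ((r a).2 i) < g ((r b).2 i) + g ((r b).2 j)) →
      (∀ a b : Fin (n + 1), a < b → ∀ i j k : Fin 3, i ≠ j → k ≠ i → k ≠ j → (r a).1 = Equiv.swap i j →
        (r a).2 i = (r a).2 j → (r b).1 i = j → (r b).1 j = k → (r b).1 k = i →
        g ((r a).2 k) + g ((r a).2 i) < g ((r b).2 j) + g ((r b).2 k)) →
      (∀ a b : Fin (n + 1), a < b → ∀ i j k : Fin 3, i ≠ j → k ≠ i → k ≠ j → (r a).1 i = j → (r a).1 j = k → (r a).1 k = i →
        (r b).1 = Equiv.swap i j → (r b).2 i = (r b).2 j → g ((r a).2 j) + g ((r a).2 k) < g ((r b).2 k) + g ((r b).2 i)) →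
      (∀ a b : Fin (n + 1), a < b → (r a).1 = 1 → ∀ i j k : Fin 3, i ≠ j → k ≠ i → k ≠ j →
        (r b).1 i = j → (r b).1 j = k → (r b).1 k = i → g ((r a).2 i) + g ((r a).2 j) < 2 * g ((r b).2 i)) →
      (∀ a b : Fin (n + 1), a < b → (r b).1 = 1 → ∀ i j k : Fin 3, i ≠ j → k ≠ i → k ≠ j →
        (r a).1 i = j → (r a).1 j = k → (r a).1 k = i → 2 * g ((r a).2 i) < g ((r b).2 i) + g ((r b).2 j)) → n ≤ 16 := by
  intro h
  obtain ⟨n, r, g, hn, hmono, hshape, hM, h3, hR1, hR1', hR2, hR2', hR3, hR3', -⟩ := core_hypotheses_admit_seventeen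
  have := h n r g hmono hshape hM h3 hR1 hR1' hR2 hR2' hR3 hR3'
  omega

end SymmetricOrbitThreeFour

end Summit.ValiantsHypothesis.ValiantsHypothesis.Theorems.KPlusLogSqLaw
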